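import Literature.LinearAlgebra.Matrix.Pfaffian

/-!
# The Pfaffian of an alternating matrix, II: alien-cofactor identity, equal adjacent rows

Continuation of `Pfaffian.lean` (Laplace-type definition of `pfaffian`).  For an ALTERNATING
matrix (`Yᵀ = -Y`, zero diagonal) over an arbitrary commutative ring we prove, from the
definition alone:
* `sum_neg_one_pow_mul_pfaffian_erase_eq_zero` — Kustin–Ulrich's Laplace identity (1.18),
  `Σ_j (-1)^j x_{ij} X(kj) = (-1)^{i+1} δ_{ik} pf X`, in the "alien" case `i ≠ k`, `i = 1`, read on
  the odd-sized alternating matrix `W` = `X` with row and column `k` removed: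
  `Σ_c (-1)^c · W 0 c · pf (W with row/column c deleted) = 0`.  Proof: expand each sub-Pfaffian
  along its first row; the resulting double sum over ordered pairs `(c, d)` is antisymmetric under
  `c ↔ d` (a fixed-point-free involution).
* `pfaffian_eq_zero_of_row_castSucc_eq_row_succ` — an alternating matrix with two equal ADJACENT
  rows (hence columns) has Pfaffian `0`: the instance needed in the sequel of "if the `2r × 2r`
  matrix `M` has rank less than `2r`, then `Pf(M) = 0`" (Anderson–Fulton C.1) — the alternating
  property behind Krauth's second rule (§6.2.3: the Pfaffian "changes sign if … both the rows `i`
  and `j` and the columns `i` and `j` are interchanged"); over a general ring we prove vanishing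
  directly.  Rows `0, 1`: by the identity above; rows `r, r+1`, `r ≥ 1`: the two expansion terms
  through columns `r`, `r+1` cancel and the others vanish by induction.
  General form (rows `i ≠ j` at any distance, any commutative ring): `pfaffian_eq_zero_of_row_eq` in
  `PfaffianCongruence.lean`.

References: A. R. Kustin, B. Ulrich, Mem. Amer. Math. Soc. **95** (1992) no. 461, §1 (1.18)
[KustinUlrich1992]; D. Anderson, W. Fulton, *Equivariant Cohomology in Algebraic Geometry* (2023),
App. C.1 [AndersonFulton2023]; W. Krauth, *Statistical Mechanics: Algorithms and Computations*
(2006), §6.2.3, transformation rules after eqn (6.18) [Krauth2006].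
-/

namespace Literature.LinearAlgebra.Matrix

open Finset
open _root_.Matrix

variable {R : Type*} [CommRing R]

/-! ## Index bookkeeping -/

/-- Value of `Fin.succAbove`: `p.succAbove i = i` if `i < p`, else `i + 1`. [folklore] -/
private theorem val_succAbove {m : ℕ} (p : Fin (m + 1)) (i : Fin m) :
    ((p.succAbove i : Fin (m + 1)) : ℕ) = if (i : ℕ) < p then (i : ℕ) else i + 1 := by
  rcases lt_or_ge (Fin.castSucc i) p with h | h
  · rw [Fin.succAbove_of_castSucc_lt _ _ h, if_pos (by simpa [Fin.lt_def] using h)]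
    rfl
  · rw [Fin.succAbove_of_le_castSucc _ _ h,
      if_neg (not_lt.mpr (by simpa [Fin.le_def] using h))]
    simp

omit [CommRing R] in
/-- An alternating matrix stays alternating under `submatrix f f`. [folklore] -/
private theorem transpose_submatrix_eq_neg {m k : ℕ} (Y : Matrix (Fin m) (Fin m) R) [Neg R]
    (hT : Yᵀ = -Y) (f : Fin k → Fin m) : (Y.submatrix f f)ᵀ = -Y.submatrix f f := by
  rw [transpose_submatrix, hT]
  rfl

omit [CommRing R] in
/-- Iterated minors: `pfMinor (W.submatrix f f) k = W.submatrix (f ∘ succ ∘ k.succAbove) _`.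
[folklore] -/
private theorem pfMinor_submatrix {q m : ℕ} (W : Matrix (Fin m) (Fin m) R) (f : Fin (q + 2) → Fin m)
    (k : Fin (q + 1)) :
    pfMinor (W.submatrix f f) k =
      W.submatrix (f ∘ Fin.succ ∘ k.succAbove) (f ∘ Fin.succ ∘ k.succAbove) := rfl

/-- The involution `(c', k) ↦ (d', k')` on (column, sub-column) index pairs of the double
expansion: in values, with `c = c'+1` and `d =` the `(k+1)`-st index skipping `c`,
it exchanges the roles of `c` and `d`. [folklore] -/
private def phi (q : ℕ) (p : Fin (q + 2) × Fin (q + 1)) : Fin (q + 2) × Fin (q + 1) :=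
  if h : (p.2 : ℕ) < p.1 then (⟨p.2, by omega⟩, ⟨p.1 - 1, by omega⟩)
  else (⟨p.2 + 1, by omega⟩, ⟨p.1, by omega⟩)

/-- First component of `phi`, as a natural number. [folklore] -/
private theorem phi_fst_val (q : ℕ) (p : Fin (q + 2) × Fin (q + 1)) :
    ((phi q p).1 : ℕ) = if (p.2 : ℕ) < p.1 then (p.2 : ℕ) else p.2 + 1 := by
  unfold phi
  split_ifs <;> rfl

/-- Second component of `phi`, as a natural number. [folklore] -/
private theorem phi_snd_val (q : ℕ) (p : Fin (q + 2) × Fin (q + 1)) :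
    ((phi q p).2 : ℕ) = if (p.2 : ℕ) < p.1 then (p.1 : ℕ) - 1 else p.1 := by
  unfold phi
  split_ifs <;> rfl

/-- `phi` is an involution. [folklore] -/
private theorem phi_phi (q : ℕ) (p : Fin (q + 2) × Fin (q + 1)) : phi q (phi q p) = p := by
  refine Prod.ext (Fin.ext ?_) (Fin.ext ?_)
  · rw [phi_fst_val, phi_fst_val, phi_snd_val]
    split_ifs <;> omega
  · rw [phi_snd_val, phi_fst_val, phi_snd_val]
    split_ifs <;> omega

/-- `phi` has no fixed point. [folklore] -/
private theorem phi_ne (q : ℕ) (p : Fin (q + 2) × Fin (q + 1)) : phi q p ≠ p := by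
  intro h
  have h1 := congrArg (fun x : Fin (q + 2) × Fin (q + 1) => (x.1 : ℕ)) h
  simp only [phi_fst_val] at h1
  split_ifs at h1 <;> omega

/-- `c (φ p) = d p`: the first index of `φ p`, shifted by one, is the index `d` skipped to in `p`.
[folklore] -/
private theorem succ_phi_fst (q : ℕ) (p : Fin (q + 2) × Fin (q + 1)) :
    ((phi q p).1.succ : Fin (q + 3)) = (p.1.succ).succAbove p.2.succ := by
  apply Fin.ext
  simp only [Fin.val_succ, phi_fst_val, val_succAbove]
  split_ifs <;> omega

/-- `d (φ p) = c p`. [folklore] -/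
private theorem succAbove_phi (q : ℕ) (p : Fin (q + 2) × Fin (q + 1)) :
    ((phi q p).1.succ).succAbove (phi q p).2.succ = (p.1.succ : Fin (q + 3)) := by
  apply Fin.ext
  simp only [Fin.val_succ, phi_fst_val, phi_snd_val, val_succAbove]
  split_ifs <;> omega

/-- `e (φ p) = e p`: both index pairs delete the same three indices `{0, c, d}`, so the increasing
embeddings of the complement coincide. [folklore] -/
private theorem embed_phi (q : ℕ) (p : Fin (q + 2) × Fin (q + 1)) :
    (((phi q p).1.succ).succAbove ∘ Fin.succ ∘ (phi q p).2.succAbove : Fin q → Fin (q + 3)) =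
      (p.1.succ).succAbove ∘ Fin.succ ∘ p.2.succAbove := by
  funext i
  apply Fin.ext
  simp only [Function.comp_apply, Fin.val_succ, phi_fst_val, phi_snd_val, val_succAbove]
  split_ifs <;> omega

/-- Sign flip `s (φ p) = -s p` for `s (c', k) = (-1)^{c'} (-1)^k`. [folklore] -/
private theorem sign_phi (q : ℕ) (p : Fin (q + 2) × Fin (q + 1)) :
    ((-1 : R) ^ ((phi q p).1 : ℕ)) * (-1) ^ ((phi q p).2 : ℕ) =
      -(((-1 : R) ^ (p.1 : ℕ)) * (-1) ^ (p.2 : ℕ)) := by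
  rw [phi_fst_val, phi_snd_val]
  split_ifs with h
  · obtain ⟨m, hm⟩ : ∃ m : ℕ, (p.1 : ℕ) = m + 1 := ⟨p.1 - 1, by omega⟩
    rw [hm, Nat.add_sub_cancel, pow_succ]
    ring
  · rw [pow_succ]
    ring

/-! ## The alien-cofactor identity -/

/-- **Laplace expansion of a Pfaffian with alien cofactors** — the case `i ≠ k` (`i = 1`) of
Kustin–Ulrich's `Σ_j (-1)^j x_{ij} X(kj) = (-1)^{i+1} δ_{ik} pf(X)`, read on the odd-sized
alternating matrix `W` (= `X` with row and column `k` removed; any odd size, any commutative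
ring): `Σ_c (-1)^c · W 0 c · pf (W with row and column c deleted) = 0`.
(For `c = 0` the term vanishes as `W 0 0 = 0`; expanding the remaining sub-Pfaffians along their
first row gives a double sum antisymmetric under exchanging the two deleted indices.)
[cite: KustinUlrich1992, §1 (1.18)] -/
theorem sum_neg_one_pow_mul_pfaffian_erase_eq_zero :
    ∀ {N : ℕ} (W : Matrix (Fin (N + 1)) (Fin (N + 1)) R), Wᵀ = -W → (∀ i, W i i = 0) →
      ∑ c : Fin (N + 1), (-1) ^ (c : ℕ) * W 0 c * pfaffian (W.submatrix c.succAbove c.succAbove)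
        = 0
  | 0, W, _, hd => by simp [hd]
  | 1, W, _, _ => by simp
  | q + 2, W, hT, hd => by
      have h0 : ∀ c' : Fin (q + 2), (c'.succ).succAbove (0 : Fin (q + 2)) = 0 := fun c' =>
        Fin.succAbove_ne_zero_zero (Fin.succ_ne_zero c')
      rw [Fin.sum_univ_succ, hd 0]
      simp only [mul_zero, zero_mul, zero_add]
      simp_rw [pfaffian_fin_add_two, Finset.mul_sum]
      rw [← Fintype.sum_prod_type']
      refine Finset.sum_involution (fun p _ => phi q p) ?_ ?_ ?_ ?_
      · intro p _
        simp only [submatrix_apply, pfMinor_submatrix, h0, embed_phi, succAbove_phi, Fin.val_succ,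
          pow_succ]
        rw [succ_phi_fst]
        have hs := sign_phi (R := R) q p
        linear_combination (-(W 0 p.1.succ * W 0 (p.1.succ.succAbove p.2.succ) *
          pfaffian (W.submatrix (p.1.succ.succAbove ∘ Fin.succ ∘ p.2.succAbove)
            (p.1.succ.succAbove ∘ Fin.succ ∘ p.2.succAbove)))) * hs
      · intro p _ _
        exact phi_ne q p
      · intro p _
        exact Finset.mem_univ _
      · intro p _
        exact phi_phi q p

/-! ## Equal adjacent rows -/

/-- For `p : Fin n`, the two minors of an `(n+2) × (n+2)` alternating matrix through columns
`p+1` and `p+2` coincide when rows (and columns) `p+1`, `p+2` are equal. [folklore] -/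
private theorem pfMinor_castSucc_eq_pfMinor_succ {n : ℕ} (Y : Matrix (Fin (n + 2)) (Fin (n + 2)) R)
    (hT : Yᵀ = -Y) (hd : ∀ i, Y i i = 0) (p : Fin n)
    (hrow : Y p.succ.castSucc = Y p.succ.succ) :
    pfMinor Y p.castSucc = pfMinor Y p.succ := by
  have halt : ∀ x y, Y y x = -Y x y := fun x y => by
    simpa using congrFun (congrFun hT x) y
  have hne : ∀ a : Fin n, a ≠ p → p.castSucc.succAbove a = p.succ.succAbove a := by
    intro a ha
    apply Fin.ext
    have : (a : ℕ) ≠ p := fun h => ha (Fin.ext h)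
    simp only [val_succAbove, Fin.val_castSucc, Fin.val_succ]
    split_ifs <;> omega
  have h1 : p.castSucc.succAbove p = p.succ := by
    apply Fin.ext
    simp only [val_succAbove, Fin.val_castSucc, Fin.val_succ, lt_irrefl, if_false]
  have h2 : p.succ.succAbove p = p.castSucc := by
    apply Fin.ext
    simp only [val_succAbove, Fin.val_castSucc, Fin.val_succ, Nat.lt_succ_self, if_true]
  have hr : ∀ x, Y p.castSucc.succ x = Y p.succ.succ x := fun x => by
    rw [Fin.succ_castSucc]; exact congrFun hrow x
  ext a b
  simp only [pfMinor_apply]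
  by_cases ha : a = p
  · rw [ha]
    by_cases hb : b = p
    · rw [hb, h1, h2, hd, hd]
    · rw [h1, h2, hne b hb, ← hr]
  · by_cases hb : b = p
    · rw [hb, h1, h2, hne a ha, halt p.succ.succ, ← hr, halt p.castSucc.succ]
    · rw [hne a ha, hne b hb]

/-- **An alternating matrix with two equal adjacent rows (and columns) has Pfaffian zero**, over
any commutative ring — the instance used in the sequels of Anderson–Fulton's "if the `2r × 2r`
matrix `M` has rank less than `2r`, then `Pf(M) = 0`" (App. C.1; the alternating property behind
Krauth's second rule, §6.2.3).
General form (rows `i ≠ j` at any distance): `pfaffian_eq_zero_of_row_eq` in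
`PfaffianCongruence.lean`.
[cite: AndersonFulton2023, App. C.1] -/
theorem pfaffian_eq_zero_of_row_castSucc_eq_row_succ :
    ∀ {n : ℕ} (Y : Matrix (Fin (n + 2)) (Fin (n + 2)) R) (r : Fin (n + 1)),
      Yᵀ = -Y → (∀ i, Y i i = 0) → Y r.castSucc = Y r.succ → pfaffian Y = 0
  | 0, Y, r, _, hd, hrow => by
      have hr : r = 0 := Fin.ext (by have := r.isLt; omega)
      subst hr
      rw [pfaffian_fin_two]
      have := congrFun hrow 1
      simp only [Fin.castSucc_zero, Fin.succ_zero_eq_one, hd] at this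
      exact this
  | 1, Y, _, _, _, _ => pfaffian_eq_zero_of_odd Y ⟨1, rfl⟩
  | m + 2, Y, r, hT, hd, hrow => by
      have halt : ∀ x y, Y y x = -Y x y := fun x y => by
        simpa using congrFun (congrFun hT x) y
      induction r using Fin.cases with
      | zero =>
          -- rows 0 and 1 are equal: alien expansion of `W = Y` minus its 0-th cross
          rw [pfaffian_fin_add_two]
          have h01 : ∀ j : Fin (m + 3), Y 0 j.succ = Y 1 j.succ := fun j => by
            have := congrFun hrow j.succ
            simpa using this
          have key := sum_neg_one_pow_mul_pfaffian_erase_eq_zero (Y.submatrix Fin.succ Fin.succ)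
            (transpose_submatrix_eq_neg Y hT _) (fun i => hd _)
          refine Eq.trans (Finset.sum_congr rfl fun j _ => ?_) key
          rw [h01]
          rfl
      | succ p =>
          -- rows p+1 and p+2 are equal
          rw [pfaffian_fin_add_two]
          have hne : (p.castSucc : Fin (m + 3)) ≠ p.succ := (Fin.castSucc_lt_succ (i := p)).ne
          have hrest : ∀ j : Fin (m + 3), j ≠ p.castSucc ∧ j ≠ p.succ →
              (fun j : Fin (m + 3) => (-1) ^ (j : ℕ) * Y 0 j.succ * pfaffian (pfMinor Y j)) j
                = 0 := by
            rintro j ⟨hj1, hj2⟩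
            have hj1' : (j : ℕ) ≠ p := fun h => hj1 (Fin.ext (by simpa using h))
            have hj2' : (j : ℕ) ≠ p + 1 := fun h => hj2 (Fin.ext (by simpa using h))
            have hpm : (j : ℕ) < p ∨ (p : ℕ) + 1 < j := by omega
            -- position `r'` of the equal rows inside the minor
            obtain ⟨r', h1, h2⟩ : ∃ r' : Fin (m + 1),
                ((j.succAbove r'.castSucc).succ : Fin (m + 4)) = p.succ.castSucc ∧
                ((j.succAbove r'.succ).succ : Fin (m + 4)) = p.succ.succ := by
              rcases hpm with h | h
              · refine ⟨⟨p - 1, by omega⟩, Fin.ext ?_, Fin.ext ?_⟩ <;>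
                  simp only [Fin.val_succ, val_succAbove, Fin.val_castSucc] <;>
                  split_ifs <;> omega
              · refine ⟨⟨p, by omega⟩, Fin.ext ?_, Fin.ext ?_⟩ <;>
                  simp only [Fin.val_succ, val_succAbove, Fin.val_castSucc] <;>
                  split_ifs <;> omega
            have hrow' : (pfMinor Y j) r'.castSucc = (pfMinor Y j) r'.succ := by
              funext b
              simp only [pfMinor_apply, h1, h2]
              exact congrFun hrow _
            show (-1) ^ (j : ℕ) * Y 0 j.succ * pfaffian (pfMinor Y j) = 0
            rw [pfaffian_eq_zero_of_row_castSucc_eq_row_succ (pfMinor Y j) r'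
              (transpose_submatrix_eq_neg Y hT _) (fun i => hd _) hrow', mul_zero]
          rw [Fintype.sum_eq_add _ _ hne hrest]
          have hcol : Y 0 p.castSucc.succ = Y 0 p.succ.succ := by
            rw [halt p.castSucc.succ 0, halt p.succ.succ 0, Fin.succ_castSucc]
            exact congrArg Neg.neg (congrFun hrow 0)
          rw [hcol, pfMinor_castSucc_eq_pfMinor_succ Y hT hd p hrow, Fin.val_castSucc,
            Fin.val_succ, pow_succ]
          ring

end Literature.LinearAlgebra.Matrix
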